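import Summits.QuantumFields.YangMills.Theorems.BalabanUVNodesN11TStepOldBranchPrivateInnerChartOfLaws
import Summits.QuantumFields.YangMills.Theorems.BalabanUVNodesN11Sect3SupplyChainDefs

/-!
# DAG node N11 — `PresentChildObligations` AT A 𝐓-PRESENT CHILD FROM ITS BOUNDS (O1′)∕(O2) AND THE CHARTED (O3′): the producer for dag-n11-e's `SupplierObligations.present`,
# inside step in private coordinates, no integrability row on the new side

HEADER — WORK-UNIT METADATA.  Cell `pub-ymgap`, YM-PLAN Track A (HUMAN RULING D-0062), seat `pub-ymgap-dag-n11-d` (g15; R134 fan-out base seat N11 [B14], strategy s2),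
route `BalabanUVNodes` rev 28∕29, item K1⁹ `StabilityBRunRowsAtRecordR13SepCoPHV` = stmt-QuantumFields-27364 (helper lane, `--kind proof --supports 27364 --as helper`,
count-neutral).  [III] = [Balaban1988Convergent].  Composition of this seat's `…N11TStepOldBranchPrivateInnerChartOfLaws` (★★★★★★★ the (O3′) DISJUNCTION at a v1.7 parameter from
Theorem 1's level-`k` form, def-T's graph integrability, `zhLaws`, rows, per-bond inversion data off `sV′`, the support clause, joint measurability of the new inside integrands and
ONE explicit integral identity per old branch) with dag-n11-e's `…N11Sect3SupplyChainDefs.PresentChildObligations` (the per-child deliverable of `SupplierObligations.present`).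

WHY THIS FILE.  `SupplierObligations.present` (dag-n11-e `…ObligationsDefs`) asks, for every level `k < K` with the chain's inductive hypothesis `ChainFormAt θ p σ k` and every
𝐓-present expansion child `s′`, the conjunction `PresentChildObligations θ p k t tnew EkN s′` = (O1′) the supplier's own `𝐁^{(k)}` bound + analyticity on the child's space ∧ (O2) r11's
new-term obligations `Step.LFNewTerms` + analyticity of the new `𝐄 ∕ 𝐑 ∕ 𝐁` at `k+1` ∧ (O3′) the 𝐓-image identity for the splice `graftAboveB k (t s′.init) (tnew s′)` with the constant
`EkN s′`.  THIS FILE is the producer: (O1′) and (O2) DISPLAYED verbatim (they are [III] Thm 2's BOUNDS — analysis, not bookkeeping), (O3′) from this seat's road.  So a §3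
supplier's per-child work reads, BY NAME: «bounds (O1′)+(O2) for your new terms + ONE explicit integral identity per old branch (+ the per-bond inversion data, the support
clause and the measurability rows)».

WHAT THIS FILE PROVES (0 `def`, 0 `sorry`, standard axioms).  ★★★★★★★ `presentChildObligations_of_bounds_of_hasSect2FormAtZS_of_privateInnerChart`.

HONEST FRAMING.  Helper lane of K1⁹; count-neutral; ONE anonymous-constructor composition; (O1′), (O2), the per-bond data, the rows, the level-`k` form and the integral identity
are DISPLAYED hypotheses; nothing of [I] §2 ∕ [III] §3 ∕ Thm 2 asserted; (B4) ∕ (S-α) ∕ (O3′) NOT closed; N11 NOT discharged; K1⁹ NOT closed, no registered stub touched; counts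
unmoved (typed 28∕28 · discharged 5∕27 · A 5∕28).  One finite `𝕋⁴_{L^K}` programme at fixed `ε = L^{−K}`; R4 closes only the conditional finite-𝕋⁴ rung `BalabanLadder.UV` — NOT ℝ⁴,
NOT OS, NOT a mass gap, NOT Clay.  No `sorry`, `axiom`, `def`, `instance`, `notation`.  Sources (SHAPE ∕ bookkeeping only): [III] Thm 2 p.263, §3 p.279, (3.24)–(3.25) p.270,
(2.27)–(2.31) pp.259–260, (2.38)–(2.42) p.261.
-/

noncomputable section

open MeasureTheory ProbabilityTheory Set Function
open scoped ENNReal NNReal BigOperators Matrix.Norms.L2Operator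

namespace Summit.QuantumFields.YangMills.Theorems.BalabanUVNodesN11PresentChildO3OfPrivateInnerChart

open Literature.MathematicalPhysics.QuantumFieldTheory.Balaban1983to89
open Literature.MathematicalPhysics.QuantumFieldTheory.Balaban1983to89.T4AveragingDisintegration
open BalabanUVNodesN11TStepOldBranchPrivateInnerChartOfLaws (slotsTOfRecord₁₃H_succ_O3_of_hasSect2FormAtZS_of_privateInnerChart_of_laws)
open BalabanUVNodesN11Sect3SupplyChainDefs (PresentChildObligations)
open BalabanUVNodesN11Sect3SupplySpliceOwnBoundary (graftAboveB)
open Literature.MathematicalPhysics.QuantumFieldTheory.Balaban1983to89.BlockAveragingHaarAC (centralBond)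
open Node00 hiding SU
open Node00.Tk T4Continuum B14.Eq218Concrete
open B10Eq42TorusConstraint (bondsIn)

variable {F : T4Family} {N : ℕ} [NeZero N]

/-- ★★★★★★★ **`PresentChildObligations θ p k t tnew EkN s′` FROM (O1′) + (O2) DISPLAYED AND THE CHARTED (O3′).**  See the module docstring; the (O3′) hypotheses are those of
`…PrivateInnerChartOfLaws` at `t′ := graftAboveB k (t s′.init) (tnew s′)`, `E′ := EkN s′`. [cite: Balaban1988Convergent, Thm 2 p.263, §3 p.279, (3.24)–(3.25) p.270, (2.27)–(2.31) pp.259–260, (2.38)–(2.42) p.261] -/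
theorem presentChildObligations_of_bounds_of_hasSect2FormAtZS_of_privateInnerChart (θ : Stage13HParams F N) (p : B12.RunParams) {k : ℕ} (hkK : k < p.K)
    {hdec : DecidableEq (PBond (F.P p.K) k)} {hdec' : DecidableEq (PBond (F.P p.K) (k + 1))} (hk : k + 1 ≤ (F.P p.K).m + (F.P p.K).K)
    (s' : SeqOfRecord F θ.ν θ.τ9.M (gOfRecord₁₃ F N θ.toStage13Params p) p.K (k + 1))
    {law : SeqOfRecord F θ.ν θ.τ9.M (gOfRecord₁₃ F N θ.toStage13Params p) p.K k → Sect2.TermValues (F.P p.K) (MatA N) (FluctV N) θ.τ9.M → Prop}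
    {t : SeqOfRecord F θ.ν θ.τ9.M (gOfRecord₁₃ F N θ.toStage13Params p) p.K k → Sect2.TermValues (F.P p.K) (MatA N) (FluctV N) θ.τ9.M}
    {Ek : SeqOfRecord F θ.ν θ.τ9.M (gOfRecord₁₃ F N θ.toStage13Params p) p.K k → ℝ}
    (hform : HasSect2FormAtZS F N (FluctV N) p.K (settingOfRecord₁₃ F N θ.toStage13Params p) k (θ.rzAt p) (WtOfRecord₁₃H F N θ p)
      (UbgOfRecord₁₃CoP F N θ.toStage13Params p k) law
      (slotsOfRecord F N θ.ν θ.τ9 (EOfRecord₁₃ F N θ.toStage13Params) (wOfRecord₉ F N θ.toStage9Params) θ.ppSel p (gOfRecord₁₃ F N θ.toStage13Params p) k) t Ek)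
    (tnew : SeqOfRecord F θ.ν θ.τ9.M (gOfRecord₁₃ F N θ.toStage13Params p) p.K (k + 1) → Sect2.TermValues (F.P p.K) (MatA N) (FluctV N) θ.τ9.M)
    (EkN : SeqOfRecord F θ.ν θ.τ9.M (gOfRecord₁₃ F N θ.toStage13Params p) p.K (k + 1) → ℝ)
    -- def-T's graph integrability of the step + the residual law + nonnegativity ∕ measurability rows (dag-n11-e's `ResidualRowsAt` ∕ `OperandRowsAt` shapes)
    (hG : Integrable (fun U => wOfRecord₉ F N θ.toStage9Params p (gOfRecord₁₃ F N θ.toStage13Params p) k s' U ((avOfRecord F N p.K k).avg U) *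
      (chiSeqOfRecord F N θ.ν θ.τ9.M (gOfRecord₁₃ F N θ.toStage13Params p) p.K k s'.init U *
        slotsOfRecord F N θ.ν θ.τ9 (EOfRecord₁₃ F N θ.toStage13Params) (wOfRecord₉ F N θ.toStage9Params) θ.ppSel p (gOfRecord₁₃ F N θ.toStage13Params p) k s'.init U))
      (fieldMeasure (F.P p.K) k (SU N)))
    (hZ : ∀ p n Ω Λ, (θ.Zh p n Ω Λ).Laws)
    (hw0 : ∀ U, 0 ≤ wOfRecord₉ F N θ.toStage9Params p (gOfRecord₁₃ F N θ.toStage13Params p) k s' U ((avOfRecord F N p.K k).avg U))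
    (hwm : Measurable fun U => wOfRecord₉ F N θ.toStage9Params p (gOfRecord₁₃ F N θ.toStage13Params p) k s' U ((avOfRecord F N p.K k).avg U))
    (hχm : Measurable fun U => chiSeqOfRecord F N θ.ν θ.τ9.M (gOfRecord₁₃ F N θ.toStage13Params p) p.K k s'.init U)
    (hζ0m : ∀ j Y, Measurable ((θ.zhAt p s'.init).ζ0 j Y)) (hqm : ∀ j Λ', Measurable ((θ.zhAt p s'.init).quad j Λ'))
    (hΦ₀m : ∀ S₀ ∈ admSOfRecord F θ.ν θ.τ9.M (gOfRecord₁₃ F N θ.toStage13Params p) p.K k s'.init,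
      Measurable fun ω : MultiCfg (F.P p.K) (SU N) (FluctV N) =>
        (sect2Operand F N (FluctV N) p.K (settingOfRecord₁₃ F N θ.toStage13Params p) (θ.rzAt p s'.init) s'.init (t s'.init) (Ek s'.init)
            (UbgOfRecord₁₃CoP F N θ.toStage13Params p k s'.init)) (S₀, fun j => (ω j).2) (fun j => (ω j).1))
    -- dag-n11-w6 ∕ dag-n09-w6's per-bond inversion data of the (0.4) fibre maps, used only at the coarse bonds off `sV′`
    (hβ' : ∀ c : PBond (F.P p.K) (k + 1), c ∉ (Set.toFinite (bondsIn (k + 1) (s'.Ω (k + 1))ᶜ)).toFinset → centralBond c ∉ (Set.toFinite (bondsIn k (s'.Ω (k + 1))ᶜ)).toFinset)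
    (Ω T : PBond (F.P p.K) (k + 1) → GaugeField (F.P p.K) k (SU N) → Set (SU N))
    (ϑ : PBond (F.P p.K) (k + 1) → GaugeField (F.P p.K) k (SU N) → SU N → SU N)
    (jd : PBond (F.P p.K) (k + 1) → GaugeField (F.P p.K) k (SU N) → SU N → ℝ≥0)
    (hΩm : ∀ c, MeasurableSet {p : GaugeField (F.P p.K) k (SU N) × SU N | p.2 ∈ Ω c p.1})
    (hTm : ∀ c, MeasurableSet {p : GaugeField (F.P p.K) k (SU N) × SU N | p.2 ∈ T c p.1})
    (hθm : ∀ c, Measurable fun p : GaugeField (F.P p.K) k (SU N) × SU N => ϑ c p.1 p.2)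
    (hjm : ∀ c, Measurable fun p : GaugeField (F.P p.K) k (SU N) × SU N => jd c p.1 p.2)
    (hΩbl : ∀ c (U : GaugeField (F.P p.K) k (SU N)) (g' : PBond (F.P p.K) (k + 1) → SU N), Ω c (extend centralBond g' U) = Ω c U)
    (hright : ∀ c U, ∀ v ∈ T c U, (avOfRecord F N p.K k).avg (update U (centralBond c) (ϑ c U v)) c = v)
    (hlaw : ∀ c U, (HaarData.haar : Measure (SU N)).restrict (Ω c U) =
      (((HaarData.haar : Measure (SU N)).restrict (T c U)).withDensity fun v => (jd c U v : ℝ≥0∞)).map (ϑ c U))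
    -- the support clause ((3.2)–(3.5))
    (hwS : ∀ q : (↥(Set.toFinite (bondsIn k (s'.Ω (k + 1))ᶜ)).toFinset → SU N) × ({b : PBond (F.P p.K) k // b ∉ (Set.toFinite (bondsIn k (s'.Ω (k + 1))ᶜ)).toFinset} → SU N),
      wOfRecord₉ F N θ.toStage9Params p (gOfRecord₁₃ F N θ.toStage13Params p) k s' (⇑(MeasurableEquiv.piEquivPiSubtypeProd (fun _ : PBond (F.P p.K) k => SU N)
            (· ∈ (Set.toFinite (bondsIn k (s'.Ω (k + 1))ᶜ)).toFinset)).symm q) ((avOfRecord F N p.K k).avg (⇑(MeasurableEquiv.piEquivPiSubtypeProd (fun _ : PBond (F.P p.K) k => SU N)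
            (· ∈ (Set.toFinite (bondsIn k (s'.Ω (k + 1))ᶜ)).toFinset)).symm q)) ≠ 0 →
        ∀ c : {c : PBond (F.P p.K) (k + 1) // c ∉ (Set.toFinite (bondsIn (k + 1) (s'.Ω (k + 1))ᶜ)).toFinset}, q.2 ⟨centralBond (c : PBond (F.P p.K) (k + 1)), hβ' c c.2⟩ ∈ Ω c ((MeasurableEquiv.piEquivPiSubtypeProd (fun _ : PBond (F.P p.K) k => SU N) (· ∈ (Set.toFinite (bondsIn k (s'.Ω (k + 1))ᶜ)).toFinset)).symm q))
    -- dag-n11-w2's row: joint measurability of the NEW inside integrands (their graph integrability follows from the weight laws + positivity, p624357)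
    (hgm : ∀ S ∈ admSOfRecord F θ.ν θ.τ9.M (gOfRecord₁₃ F N θ.toStage13Params p) p.K (k + 1) s', Measurable fun x :
        ((↥(Set.toFinite (bondsIn (k + 1) (s'.Ω (k + 1))ᶜ)).toFinset → SU N) × ({c : PBond (F.P p.K) (k + 1) // c ∉ (Set.toFinite (bondsIn (k + 1) (s'.Ω (k + 1))ᶜ)).toFinset} → SU N)) × (↥(Set.toFinite (bondsIn k (s'.Ω (k + 1))ᶜ)).toFinset → SU N) =>
      zetaOp (genDataOfRecord F N (FluctV N) θ.ν θ.τ9.M (gOfRecord₁₃ F N θ.toStage13Params p) p.K (WtOfRecord₁₃H F N θ p s') s' S k).ζ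
        (aOp k (genDataOfRecord F N (FluctV N) θ.ν θ.τ9.M (gOfRecord₁₃ F N θ.toStage13Params p) p.K (WtOfRecord₁₃H F N θ p s') s' S k).sA (genDataOfRecord F N (FluctV N) θ.ν θ.τ9.M (gOfRecord₁₃ F N θ.toStage13Params p) p.K (WtOfRecord₁₃H F N θ p s') s' S k).w
          (tkBranchOfRecord F N (FluctV N) θ.ν θ.τ9.M (gOfRecord₁₃ F N θ.toStage13Params p) p.K (WtOfRecord₁₃H F N θ p s') s' S k (fun ω => (sect2Operand F N (FluctV N) p.K (settingOfRecord₁₃ F N θ.toStage13Params p) (θ.rzAt p s') s' (graftAboveB k (t s'.init) (tnew s')) (EkN s')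
                  (UbgOfRecord₁₃CoP F N θ.toStage13Params p (k + 1) s')) (S, fun j => (ω j).2) (fun j => (ω j).1))))
        (Function.update (baseCfg (k + 1) ((MeasurableEquiv.piEquivPiSubtypeProd (fun _ : PBond (F.P p.K) (k + 1) => SU N)
                (· ∈ (Set.toFinite (bondsIn (k + 1) (s'.Ω (k + 1))ᶜ)).toFinset)).symm x.1)) k
          (Function.updateFinset ((baseCfg (V := FluctV N) (k + 1) ((MeasurableEquiv.piEquivPiSubtypeProd (fun _ : PBond (F.P p.K) (k + 1) => SU N)
                (· ∈ (Set.toFinite (bondsIn (k + 1) (s'.Ω (k + 1))ᶜ)).toFinset)).symm x.1)) k).1 (Set.toFinite (bondsIn k (s'.Ω (k + 1))ᶜ)).toFinset x.2,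
            ((baseCfg (V := FluctV N) (k + 1) ((MeasurableEquiv.piEquivPiSubtypeProd (fun _ : PBond (F.P p.K) (k + 1) => SU N)
                (· ∈ (Set.toFinite (bondsIn (k + 1) (s'.Ω (k + 1))ᶜ)).toFinset)).symm x.1)) k).2)))
    -- THE EXPLICIT INTEGRAL IDENTITY PER OLD BRANCH ([I] §2 + gauge fixing + ζ + [III] Thm 2 — displayed)
    (hinner₀ : ∀ᵐ q ∂((Measure.pi fun _ : ↥(Set.toFinite (bondsIn (k + 1) (s'.Ω (k + 1))ᶜ)).toFinset => (HaarData.haar : Measure (SU N))).prod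
          (Measure.pi fun _ : {c : PBond (F.P p.K) (k + 1) // c ∉ (Set.toFinite (bondsIn (k + 1) (s'.Ω (k + 1))ᶜ)).toFinset} =>
            (HaarData.haar : Measure (SU N)))),
      ∀ S₀ ∈ admSOfRecord F θ.ν θ.τ9.M (gOfRecord₁₃ F N θ.toStage13Params p) p.K k s'.init, ∀ y : ↥(Set.toFinite (bondsIn k (s'.Ω (k + 1))ᶜ)).toFinset → SU N,
        avgRestrOfRecord F N p.K k (Set.toFinite (bondsIn k (s'.Ω (k + 1))ᶜ)).toFinset (Set.toFinite (bondsIn (k + 1) (s'.Ω (k + 1))ᶜ)).toFinset y = q.1 →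
        (∫ r : ({b : PBond (F.P p.K) k // b ∉ (Set.toFinite (bondsIn k (s'.Ω (k + 1))ᶜ)).toFinset} → SU N), (({z : ((↥(Set.toFinite (bondsIn k (s'.Ω (k + 1))ᶜ)).toFinset → SU N) × ({c : PBond (F.P p.K) (k + 1) // c ∉ (Set.toFinite (bondsIn (k + 1) (s'.Ω (k + 1))ᶜ)).toFinset} → SU N)) × ({b : PBond (F.P p.K) k // b ∉ (Set.toFinite (bondsIn k (s'.Ω (k + 1))ᶜ)).toFinset} → SU N) |
              ∀ c : {c : PBond (F.P p.K) (k + 1) // c ∉ (Set.toFinite (bondsIn (k + 1) (s'.Ω (k + 1))ᶜ)).toFinset}, z.1.2 c ∈ T c ((MeasurableEquiv.piEquivPiSubtypeProd (fun _ : PBond (F.P p.K) k => SU N) (· ∈ (Set.toFinite (bondsIn k (s'.Ω (k + 1))ᶜ)).toFinset)).symm (z.1.1, z.2))}.indicator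
            (fun z => ∏ c : {c : PBond (F.P p.K) (k + 1) // c ∉ (Set.toFinite (bondsIn (k + 1) (s'.Ω (k + 1))ᶜ)).toFinset}, jd c ((MeasurableEquiv.piEquivPiSubtypeProd (fun _ : PBond (F.P p.K) k => SU N) (· ∈ (Set.toFinite (bondsIn k (s'.Ω (k + 1))ᶜ)).toFinset)).symm (z.1.1, z.2)) (z.1.2 c)) ((y, q.2), r) : ℝ≥0) : ℝ) *
          ((fun U => wOfRecord₉ F N θ.toStage9Params p (gOfRecord₁₃ F N θ.toStage13Params p) k s' U ((avOfRecord F N p.K k).avg U) *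
        (chiSeqOfRecord F N θ.ν θ.τ9.M (gOfRecord₁₃ F N θ.toStage13Params p) p.K k s'.init U *
          tkBranchOfRecord F N (FluctV N) θ.ν θ.τ9.M (gOfRecord₁₃ F N θ.toStage13Params p) p.K (WtOfRecord₁₃H F N θ p s'.init) s'.init S₀ k
            (fun ω => (sect2Operand F N (FluctV N) p.K (settingOfRecord₁₃ F N θ.toStage13Params p) (θ.rzAt p s'.init) s'.init (t s'.init) (Ek s'.init)
            (UbgOfRecord₁₃CoP F N θ.toStage13Params p k s'.init)) (S₀, fun j => (ω j).2) (fun j => (ω j).1)) (baseCfg k U))) ∘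
            ⇑(MeasurableEquiv.piEquivPiSubtypeProd (fun _ : PBond (F.P p.K) k => SU N)
            (· ∈ (Set.toFinite (bondsIn k (s'.Ω (k + 1))ᶜ)).toFinset)).symm) (y, extend (fun c : {c : PBond (F.P p.K) (k + 1) // c ∉ (Set.toFinite (bondsIn (k + 1) (s'.Ω (k + 1))ᶜ)).toFinset} =>
            (⟨centralBond (c : PBond (F.P p.K) (k + 1)), hβ' c c.2⟩ : {b : PBond (F.P p.K) k // b ∉ (Set.toFinite (bondsIn k (s'.Ω (k + 1))ᶜ)).toFinset}))
            (fun c : {c : PBond (F.P p.K) (k + 1) // c ∉ (Set.toFinite (bondsIn (k + 1) (s'.Ω (k + 1))ᶜ)).toFinset} => ϑ c ((MeasurableEquiv.piEquivPiSubtypeProd (fun _ : PBond (F.P p.K) k => SU N) (· ∈ (Set.toFinite (bondsIn k (s'.Ω (k + 1))ᶜ)).toFinset)).symm (y, r)) (q.2 c)) r) ∂(Measure.pi fun _ : {b : PBond (F.P p.K) k // b ∉ (Set.toFinite (bondsIn k (s'.Ω (k + 1))ᶜ)).toFinset} => (HaarData.haar : Measure (SU N)))) =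
          ∑ Y ∈ (Set.toFinite {Y : Set (Site (F.P p.K) 0) | Y ∈ SClassOfRecord F θ.ν (gOfRecord₁₃ F N θ.toStage13Params p) p.K (k + 1) ∧ Y ⊆ s'.Ω (k + 1) ∩ (s'.Λ (k + 1))ᶜ}).toFinset,
            zetaOp (genDataOfRecord F N (FluctV N) θ.ν θ.τ9.M (gOfRecord₁₃ F N θ.toStage13Params p) p.K (WtOfRecord₁₃H F N θ p s') s' (Function.update S₀ (k + 1) Y) k).ζ
              (aOp k (genDataOfRecord F N (FluctV N) θ.ν θ.τ9.M (gOfRecord₁₃ F N θ.toStage13Params p) p.K (WtOfRecord₁₃H F N θ p s') s' (Function.update S₀ (k + 1) Y) k).sA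
                (genDataOfRecord F N (FluctV N) θ.ν θ.τ9.M (gOfRecord₁₃ F N θ.toStage13Params p) p.K (WtOfRecord₁₃H F N θ p s') s' (Function.update S₀ (k + 1) Y) k).w
                (tkBranchOfRecord F N (FluctV N) θ.ν θ.τ9.M (gOfRecord₁₃ F N θ.toStage13Params p) p.K (WtOfRecord₁₃H F N θ p s') s'.init S₀ k
                  (fun ω => (sect2Operand F N (FluctV N) p.K (settingOfRecord₁₃ F N θ.toStage13Params p) (θ.rzAt p s') s' (graftAboveB k (t s'.init) (tnew s')) (EkN s')
                  (UbgOfRecord₁₃CoP F N θ.toStage13Params p (k + 1) s')) (Function.update S₀ (k + 1) Y, fun j => (ω j).2) (fun j => (ω j).1))))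
              (Function.update (baseCfg (k + 1) ((MeasurableEquiv.piEquivPiSubtypeProd (fun _ : PBond (F.P p.K) (k + 1) => SU N)
                (· ∈ (Set.toFinite (bondsIn (k + 1) (s'.Ω (k + 1))ᶜ)).toFinset)).symm q)) k
              (Function.updateFinset ((baseCfg (V := FluctV N) (k + 1) ((MeasurableEquiv.piEquivPiSubtypeProd (fun _ : PBond (F.P p.K) (k + 1) => SU N)
                (· ∈ (Set.toFinite (bondsIn (k + 1) (s'.Ω (k + 1))ᶜ)).toFinset)).symm q)) k).1 (Set.toFinite (bondsIn k (s'.Ω (k + 1))ᶜ)).toFinset y,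
                ((baseCfg (V := FluctV N) (k + 1) ((MeasurableEquiv.piEquivPiSubtypeProd (fun _ : PBond (F.P p.K) (k + 1) => SU N)
                (· ∈ (Set.toFinite (bondsIn (k + 1) (s'.Ω (k + 1))ᶜ)).toFinset)).symm q)) k).2)))
    -- (O1′) the supplier's own level-`k` boundary term on the child's space
    (hO1 : (1 ≤ k →
    (∀ (X : (Sect2.domSys (F.P p.K) θ.τ9.M k).Dom) (φ : Sect2.CPair (F.P p.K) (MatA N)) (a : SFluct (F.P p.K) (FluctV N)),
      φ ∈ (sect2TowerOfRecord F N (FluctV N) p.K (settingOfRecord₁₃ F N θ.toStage13Params p) (θ.rzAt p s') s' (tnew s')).spaceB k X →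
        ‖(tnew s').B k X φ a‖ ≤ (settingOfRecord₁₃ F N θ.toStage13Params p).lf.B₀ * Real.exp (-(settingOfRecord₁₃ F N θ.toStage13Params p).lf.κ * (Sect2.domSys (F.P p.K) θ.τ9.M k).dj X)) ∧
    (∀ (X : (Sect2.domSys (F.P p.K) θ.τ9.M k).Dom) (a : SFluct (F.P p.K) (FluctV N)),
      AnalyticOnNhd ℂ (fun φ => (tnew s').B k X φ a)
        ((sect2TowerOfRecord F N (FluctV N) p.K (settingOfRecord₁₃ F N θ.toStage13Params p) (θ.rzAt p s') s' (tnew s')).spaceB k X))))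
    -- (O2) r11's new-term obligations and analyticity at `k+1`
    (hO2 : Step.LFNewTerms (sect2TowerOfRecord F N (FluctV N) p.K (settingOfRecord₁₃ F N θ.toStage13Params p) (θ.rzAt p s') s' (tnew s'))
    (settingOfRecord₁₃ F N θ.toStage13Params p).lf (settingOfRecord₁₃ F N θ.toStage13Params p).βc k)
    (hO3 : (∀ (X : (Sect2.domSys (F.P p.K) θ.τ9.M (k + 1)).Dom) (z : Site (F.P p.K) (k + 1)) (g : ℝ), 0 ≤ g → g ≤ (settingOfRecord₁₃ F N θ.toStage13Params p).lf.γ →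
    AnalyticOnNhd ℂ ((tnew s').E (k + 1) X z g)
      ((sect2TowerOfRecord F N (FluctV N) p.K (settingOfRecord₁₃ F N θ.toStage13Params p) (θ.rzAt p s') s' (tnew s')).space (k + 1) X
        ((settingOfRecord₁₃ F N θ.toStage13Params p).lf.alpha0 ((settingOfRecord₁₃ F N θ.toStage13Params p).flow.g (k + 1)))
        ((settingOfRecord₁₃ F N θ.toStage13Params p).lf.alpha1 ((settingOfRecord₁₃ F N θ.toStage13Params p).flow.g (k + 1))))))
    (hO4 : (∀ X : (Sect2.domSys (F.P p.K) θ.τ9.M (k + 1)).Dom,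
    AnalyticOnNhd ℂ ((tnew s').R (k + 1) X)
      ((sect2TowerOfRecord F N (FluctV N) p.K (settingOfRecord₁₃ F N θ.toStage13Params p) (θ.rzAt p s') s' (tnew s')).space (k + 1) X
        ((settingOfRecord₁₃ F N θ.toStage13Params p).lf.alpha0 ((settingOfRecord₁₃ F N θ.toStage13Params p).flow.g (k + 1)))
        ((settingOfRecord₁₃ F N θ.toStage13Params p).lf.alpha1 ((settingOfRecord₁₃ F N θ.toStage13Params p).flow.g (k + 1))))))
    (hO5 : (∀ (X : (Sect2.domSys (F.P p.K) θ.τ9.M (k + 1)).Dom) (a : SFluct (F.P p.K) (FluctV N)),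
    AnalyticOnNhd ℂ (fun φ => (tnew s').B (k + 1) X φ a)
      ((sect2TowerOfRecord F N (FluctV N) p.K (settingOfRecord₁₃ F N θ.toStage13Params p) (θ.rzAt p s') s' (tnew s')).spaceB (k + 1) X))) :
    PresentChildObligations θ p k t tnew EkN s' :=
  ⟨hO1, hO2, hO3, hO4, hO5,
    slotsTOfRecord₁₃H_succ_O3_of_hasSect2FormAtZS_of_privateInnerChart_of_laws θ p hkK (hdec := hdec) (hdec' := hdec') hk s' hform
      (graftAboveB k (t s'.init) (tnew s')) (EkN s') hG hZ hw0 hwm hχm hζ0m hqm hΦ₀m hβ' Ω T ϑ jd hΩm hTm hθm hjm hΩbl hright hlaw hwS hgm hinner₀⟩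

end Summit.QuantumFields.YangMills.Theorems.BalabanUVNodesN11PresentChildO3OfPrivateInnerChart

end
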